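import Summits.QuantumFields.YangMills.Theorems.UnitScaleTiltHalvingHSiteBaseDataOfSocketsT
import Summits.QuantumFields.YangMills.Theorems.UnitScaleTiltHalvingHSiteTopH42OfRowsGammaD
import Summits.QuantumFields.YangMills.Theorems.UnitScaleTiltHalvingHSiteSizeRowsOfTopRowsGamma
import Summits.QuantumFields.YangMills.Theorems.UnitScaleTiltHalvingHSiteTopKnitBP
import Summits.QuantumFields.YangMills.Theorems.UnitScaleTiltHalvingHGammaComposerJoins
import HarnessLib

/-!
# `hP1room` PROGRAMME — EDITION γ, v3.1 (LEAD-H WORD 29; ★w3-19200 g9's datum-closed residual): ★★★ THE PER-SITE COMPOSER AT THE BASE MEMBER (`K − n = 1`),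
# `siteRows_of_sockets_baseTγT` = ✓`HalvingHSiteRowsOfSocketsBaseTGamma.siteRows_of_sockets_baseTγ` (p681380, v3) WITH ONE SOCKET RE-LETTERED: `H42topCrossL ↦ H42topCrossT`

Route `UnitScaleTilt`, crux K1 child «MinimiserStabilityRegPr» (stmt-QuantumFields-19200), registered stub `stub_halvingStep` (`BirthV10`).  Cell `ym3-torus` (HUMAN RULING D-0037: YM₃ on T³ is ladder
rung R3 — NOT d = 4, NOT infinite volume, NOT a mass gap, NOT the Clay problem), width seat `ym-ust-19200-w7` gen 7 (v3 = gen 6).  `--supports stmt-QuantumFields-19200 --as helper`; THEOREMS ONLY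
(0 `def`, 0 `sorry`); count-neutral; nothing here claims `hSupU`, `hMember`, a displayed socket, the stub, the crux or the gap.
WHAT CHANGED AGAINST v3 (everything else — part A ✓`baseData_of_socketsT`, `hc₁`, `SLetτ`, `HTOP` (inner top class `cubeLamB … k k k`, ε₁-route), `hTorus`, [3]'s γ windows, the `Bbd` collar rows,
T4γ ✓`siteSizeRows_of_topRows_γ`, the CONCLUSION's 22 rows — VERBATIM; see ✓p681380's docstring): v3's residual `H42topCrossL` closed over a FREE knit gauge `g′` (and free `u`), so nothing pinned `V′`
on the collar boxes ⇒ uninhabitable as typed (ym-ust-20520-w5 g9 LOCATE-2 61dadb20 §2).  v3.1 displays the k = 1 twin of ★w3-19200 g9's `H42topCrossT` (composer k ≥ 2 v3.1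
`…HSiteRowsOfSocketsTGammaT.siteRows_of_socketsTγT`; binder text VERBATIM): ∀ J3's gauge `gJ` WITH its three guards, ∀ the datum `(u₁, W, A)` and the top step's objects `(c₁, c′, κf, λ′)` WITH their rows (as `HTOP`:
`hu₁SU hW`, `0 ≤ c′`, budget, `hc₁`, `hchartTop`, `hκfs`, `hκf0`, `hsa`, `htr`, `htopId`, + the (1.108) sizes `h108`), and only then ∀ `(u, V′, A′)` with the knit predicate AT THE DATUM's OWN
knit gauge `g′₀ := ((u₁·e^{iλ′})∘rep)⁻¹·ĝJ` on ALL boxes of print's top class `cubeLamBP′ … k k k`; conclusion `∀ c ∈ cubeLamBP′ ∖ cubeLamB, ‖Q_{K−n}(iηA′)(c)‖ < 2dLα₁`.  Inside: the knit on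
print's class by ✓`HalvingHSiteTopKnitBP.hknit_of_descent_BP'` (p683007), the (1.42) line by ✓`HalvingHSiteTopH42OfRowsGammaD.H42_of_rows_γD` fed with `H42topCrossT` INSTANTIATED AT THE BASE
DATUM (`u₁ := 1`, `W := U′`, `c₁ := 2s`, `c′ := 2L(2s)`); the knit clause inside `H59γ` re-lettered to the same class (harmless for its flat discharge).  INHABITABILITY: the knit antecedent at
`g′₀` pins `V′` (hence `A′`, by locality of `logCovIter`) on every collar box ⇒ the conclusion is (M2′)'s estimate for the ACTUAL knit field (OPEN print-mechanism row: (1.29)@(k−1) at the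
outer end, the knit frame at the inner end; w5's window `W_M2`); A6 at `U = 1, gJ = 1, u₁ = 1, λ′ = 0` (`A′ = 0` on the box ⇒ LHS = 0).  A6 (WORDS 17∕29): `H59γ` at the β-clause of
`SockB9P3D4β`, class `cubeLamBP′`, lit witness ✓`sockB9P3D4γ_at_nonvacuous_cubeLamBP'_zero`.  References: Bałaban, CMP **99** 75–102 [Balaban1985RegularSpaces] (Prop. 5 p.94, Thm 4 p.88,
Prop. 3 (1.36)–(1.42) pp.82–83, (1.29) p.81, (1.59) p.86, (1.66) p.87); CMP **99** 389–434 [Balaban1985BackgroundPropagators] (Thm 3.1 p.397, Thm 3.3 p.399); CMP **96** 223–250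
[Balaban1984PropagatorsII] ((2.3) p.224); CMP **102** 277–309 [Balaban1985Variational] ((150)–(156) pp.301–302); CMP **98** 17–51 [Balaban1985Averaging] (Prop. 4 p.38, (97)–(100) p.32).
-/

set_option autoImplicit false

noncomputable section
open scoped BigOperators Matrix.Norms.L2Operator
open NormedSpace  open Complex (I)

namespace Summit.QuantumFields.YangMills.Theorems.HalvingHSiteRowsOfSocketsBaseTGammaT

open Literature.MathematicalPhysics.QuantumFieldTheory.Balaban1983to89
open Literature.MathematicalPhysics.QuantumFieldTheory.Balaban1983to89.T3ContinuumYM3Torus T4Continuum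
open Literature.MathematicalPhysics.QuantumFieldTheory.Balaban1983to89.T3PrintedRegularMinimiser (RegPr regFibrePr mem_regFibrePr_iff)
open MatrixLog (mlog) open B5Eq118OneStroke (iterBlockOf) open B7Prop1Explicit (e expUnit l1) open B7Prop1Explicit renaming Site → LSite
open B7Prop2Explicit (unitaryUnits C0 c2' avgIter) open B7Prop3Flat (c3) open B7Prop10General (C6 C4G) open B7Prop9Flat (C5') open B7Prop1Local (InBox loK bondHiK)
open B7Eq78Linearization (conjR zdBlocking QprimeIter Rbar_zero) open B7Eq92Concrete (mgauge mgauge_apply) open B8Ineq130 (tlo thi) open B8Ineq132 (covDerivFwd InAk BondTouches)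
open B8Eq119TwistedAxial (Restr129 InAx bgT) open B8Eq131Cubes (cube gs tLo tHi) open B8Eq131CubesAdmissible (cubeFam cubeFam_false_of_le) open B8CubeMemberZd (cubeLamS cubeLamB)
open B8Eq184Proof (gaugeExp cfgExp) open B8Eq182Proof (gAd) open B8Eq188Proof (frakF3) open B8Eq140Level (SideTouches) open B8Eq146AExpansion (iEta)
open B8Eq138LandauZd (IsLandau138W covDivB covLap QT logCfg) open B7Prop4GeneralLevels (logCovIter linCovIter) open B8Eq155JBound (Jcur wsup) open B8ScaledSupNorm (bondNorm msup)
open B8Eq1117Concrete (XSpace) open B8Prop5ContractionKLevel (Bd2 Mc Kc) open B8LambdaSpaceKLevel (wt) open B8Eq178Averages (Qnl) open B8SpecialUnitaryTrace (trCLM trCLM_apply trCLM_mul_comm)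
open B10Eq27TorusAxialLog (transl rel pull pull_apply unitsField toUField suIncl gaugeActT axialT unitsField_mem_unitaryUnits) open B15Eq112TorusCover (lift cover) open Node00 (coverAt)
open LatticeFieldCalculus (siteAvgIter) open Summit.QuantumFields.YangMills.Theorems.Prop8ChartDoubleBar (dbarIterU vframeU) open Summit.QuantumFields.YangMills.Theorems (FlatMinimizerH.le_T3)
open HalvingHSiteBaseDataOfSocketsT (baseData_of_socketsT) open HalvingHSiteTopH42OfRowsGammaD (H42_of_rows_γD) open B7Prop4Flat (C2 c4) open HalvingHSiteSizeRowsOfTopRowsGamma (siteSizeRows_of_topRows_γ)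
open B9SupplySockB9P3ZdBeta (CrossB) open B9SupplySockB9P3ZdGamma (cubeLamBP') open HalvingHGammaComposerJoins (hbdry_of_hBd h66_of_fine) open HalvingHSiteTopKnitBP (hknit_of_descent_BP')
open P1FlatCoreCubeInclusion (corner_of_offset room_of_level_k) open HalvingP1FlatCoreSupplierAssembly (hc₁_of_small)

variable (F : T3Family) {n K : ℕ}

set_option maxHeartbeats 400000 in
/-- ★★★ **THE PER-SITE COMPOSER AT THE BASE MEMBER (`K − n = 1`), v3.1 = EDITION γ WITH THE DATUM-CLOSED COLLAR RESIDUAL**: `hMember`'s 22-row ∃-body from the sockets —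
`SLetτ`, `H59γ` (print's split class `cubeLamBP′`, the level-0 crossing bonds, the collar allowance `Bbd·Φ₀`, the datum-gauge support clause; T-exported), `HTOP` (inner top bonds; closed inside
by ✓`H42_of_rows_γD`), the RESIDUAL `H42topCrossT` ((1.42) on the level-`k` COLLAR bonds `cubeLamBP′ … k k k ∖ cubeLamB … k k k` at the knit gauge OF THE DATUM; ★w3-19200 g9's binder VERBATIM),
`hTorus`; [3]'s five windows in the γ shape; the size rows by ✓`siteSizeRows_of_topRows_γ` (T4γ).  Conclusion = ✓p681380's, letter for letter. [cite: Balaban1985RegularSpaces, Prop. 5 (1.106)-(1.109) p.94, Thm 4 p.88, Prop. 3 (1.36)-(1.42) pp.82-83, (1.29) p.81, (1.59) p.86, (1.66) p.87, (1.131) p.99; Balaban1985BackgroundPropagators, Thm 3.1 p.397, Thm 3.3 p.399; Balaban1984PropagatorsII, (2.3) p.224; Balaban1985Variational, (2) p.278, (150)-(156) pp.301-302; Balaban1985Averaging, Prop. 4 p.38, (97)-(100) p.32, (208)-(214) p.50] -/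
theorem siteRows_of_sockets_baseTγT (L : ℕ) (hF : F.L = L) (hnK : n < K) (hKn : K - n = 1)
    (ρ S M M' : ℕ) {ρ' : ℕ} (hρ'def : ρ' = ρ + M + L + S) {ε₀ : ℝ} (hε₀ : 0 < ε₀) (hε : 10 ^ 7 * (F.L : ℝ) ^ 3 * ε₀ ≤ 1)
    {s : ℝ} (hsdef : s = (198 + 12 * (((M' : ℝ) - 1) + 4 * ρ')) * ε₀) (hs6 : s ≤ 1 / 6)
    (hroom : 2 * ρ + (M' + 1 + 2 * (M + L + S)) ≤ F.L ^ (F.m + n))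
    (V : GaugeField (F.P n) 0 (Matrix.specialUnitaryGroup (Fin 2) ℂ)) (U : GaugeField (F.P K) 0 (Matrix.specialUnitaryGroup (Fin 2) ℂ))
    (hU : U ∈ regFibrePr F n K hnK.le ε₀ V) (x₀ : Site (F.P K) 0)
    {t₀ : ℤ} (ht0 : 0 ≤ t₀) (ht : t₀ ≤ (M' : ℤ) - 1)
    {a : LSite (F.P K).d} (hadef : a = fun μ => ((iterBlockOf (K - n) x₀ μ).val : ℤ) - t₀)
    {α₁ α₄ B₀ cstar C₂ cB cA cDA Cb Cl B₀'H B₂' BG BR Bsz : ℝ}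
    (hα₁ : 0 < α₁) (hα₄ : 0 < α₄) (hB₀ : 0 < B₀) (hB₀'H : 0 < B₀'H) (hB₂' : 0 ≤ B₂') (hBG : 0 ≤ BG) (hBR : 0 ≤ BR)
    (hc : cstar = 5 * (F.P K).d * (F.P K).L * B₀ * (ε₀ + α₁))
    (hα3 : C0 (F.P K).d * (((F.P K).L : ℝ) ^ 2 * ε₀) ≤ 1 / 3) (hα4 : 4 * (((F.P K).L : ℝ) ^ 2 * ε₀) ≤ c2' (F.P K).d (F.P K).L)
    (h16 : 16 * (((F.P K).L : ℝ) * (2 * ((F.P K).L * cstar) + 8 * α₄)) ≤ 1) (hd5 : 5 * (2 * ((F.P K).L * cstar) + 8 * α₄) * (((F.P K).d : ℝ) - 1) ≤ 4)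
    (hsmallP : Real.exp (4 * (800 * (((F.P K).d : ℝ) + 1) ^ 2 * (((F.P K).d : ℝ) + 4)) * (((F.P K).L : ℝ) ^ 2 * ε₀))
      * (1 + 8 * (131072 * (((F.P K).d : ℝ) + 1) ^ 2) * (((F.P K).L : ℝ) * (2 * ((F.P K).L * cstar) + 8 * α₄))) ≤ 2)
    (hc₃P : 2 * (((F.P K).L : ℝ) * (2 * ((F.P K).L * cstar) + 8 * α₄)) ≤ c3 (F.P K).d (F.P K).L) (hside : 36 * (F.P K).d * B₀ * (2 * ((F.P K).L * cstar) + 8 * α₄) ≤ 1 / 2)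
    (h50 : 50 * (F.P K).d * (2 * ((F.P K).L * cstar) + 8 * α₄) ≤ 1)
    (hC₂ : 8 * (131072 * (((F.P K).d : ℝ) + 1) ^ 2) * Real.exp (4 * (800 * (((F.P K).d : ℝ) + 1) ^ 2 * (((F.P K).d : ℝ) + 4)) * (((F.P K).L : ℝ) ^ 2 * ε₀))
      * ((F.P K).L : ℝ) ^ 2 ≤ C₂)
    (h61 : 2 * (2 * ((F.P K).L * cstar) + 8 * α₄) ^ 2 + 20 * (F.P K).d * ε₀ * (2 * ((F.P K).L * cstar) + 8 * α₄)
      + 2 * C₂ * (2 * ((F.P K).L * cstar) + 8 * α₄) ^ 2 ≤ ε₀ + α₁)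
    (hcBlo : (F.P K).L * cstar ≤ cB)
    (hsmall : Real.exp (4 * (800 * (((F.P K).d : ℝ) + 1) ^ 2 * (((F.P K).d : ℝ) + 4)) * ε₀) * (1 + 8 * (131072 * (((F.P K).d : ℝ) + 1) ^ 2) * cB) ≤ 2)
    (hc₃ : 2 * cB ≤ c3 (F.P K).d (F.P K).L) (hsc : 2048 * ((F.P K).d : ℝ) * cB ≤ 1) (hα₃' : 40 * (F.P K).d * cB ≤ 1 / 200)
    (hs₁ : 200 * C6 (F.P K).d * (2 * α₄) ≤ 1) (hs₂ : 12000 * (((F.P K).d : ℝ) + 1) * (F.P K).L * (2 * α₄) ≤ 1)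
    (hs₃ : C4G (F.P K).d (F.P K).L * (ε₀ + 40 * (F.P K).d * cB + 4 * (2 * α₄)) ≤ 1)
    (hs₄ : 1024 * (((F.P K).d : ℝ) + 1) * (((F.P K).d : ℝ) + 4) * (F.P K).L ^ 2 * ε₀ ≤ 1)
    (hs₅ : 32 * (((F.P K).d : ℝ) + 1) ^ 2 * C6 (F.P K).d * (F.P K).L ^ 2 * ε₀ ≤ 1)
    (hs₆ : 16 * (F.P K).d * C5' (F.P K).d * C6 (F.P K).d * ((F.P K).L : ℝ) ^ 2 * ε₀ ≤ 1)
    (hprod8 : 2 * C6 (F.P K).d * (40 * (F.P K).d * cB + 4 * α₄) ≤ 1 / 8)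
    (hα70 : α₄ ≤ 1 / 70) (hcA0 : 0 ≤ cA) (hcA12 : cA ≤ 1 / 12) (hcA13 : cA ≤ 1 / 13)
    (hcAw : ((F.P K).L : ℝ) * (2 * s) ≤ cA) (hcDAw : 4 * ((F.P K).d : ℝ) * ((F.P K).L : ℝ) ^ 2 * s ≤ cDA)
    (hCb : 0 ≤ Cb) (hCl : 0 ≤ Cl) (hCbρ : Cb ≤ α₄ / (2 * B₀'H)) (hClB : Cl * B₀'H ≤ 1 / 2)
    (h2s : 2 * s ≤ cstar) (hs1 : 2 * s ≤ 1) (hbudget : 8 * 3800 * ((((F.P K).d + 2) * (F.P K).L : ℕ) : ℝ) ^ 2 * (2 * (F.P K).L * (2 * s)) ≤ 1)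
    (hcsB : cstar ≤ Bsz * ε₀)
    {Bbd : ℝ} (hBbd : 0 ≤ Bbd) (hBd : 4 * Bbd ≤ (((F.P K).d : ℝ) * (F.P K).L - 1) * B₀)
    (SLetτ : ∃ (g Δ : (LSite (F.P K).d → (Matrix (Fin 2) (Fin 2) ℂ)) →ₗ[ℂ] (LSite (F.P K).d → (Matrix (Fin 2) (Fin 2) ℂ))) (q : (LSite (F.P K).d → (Matrix (Fin 2) (Fin 2) ℂ)) →ₗ[ℂ] (ℕ → LSite (F.P K).d → (Matrix (Fin 2) (Fin 2) ℂ)))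
        (qs : (ℕ → LSite (F.P K).d → (Matrix (Fin 2) (Fin 2) ℂ)) →ₗ[ℂ] (LSite (F.P K).d → (Matrix (Fin 2) (Fin 2) ℂ))) (Aw c : (ℕ → LSite (F.P K).d → (Matrix (Fin 2) (Fin 2) ℂ)) →ₗ[ℂ] (ℕ → LSite (F.P K).d → (Matrix (Fin 2) (Fin 2) ℂ)))
        (H' : XSpace (F.P K).d (K - n) (Matrix (Fin 2) (Fin 2) ℂ) →ₗ[ℂ] (LSite (F.P K).d → (Matrix (Fin 2) (Fin 2) ℂ))),
      (∀ x, ∀ y ∈ (cubeFam false (F.P K).L a M' ρ' (K - n)) 0, (Δ (g x) + qs (Aw (q (g x)))) y = x y) ∧ (∀ f, q (g (g (qs (c (q f))))) = q f) ∧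
      (∀ (f : LSite (F.P K).d → (Matrix (Fin 2) (Fin 2) ℂ)), ∀ x ∈ (cubeFam false (F.P K).L a M' ρ' (K - n)) 0, Δ f x = covLap (((F.L : ℝ)⁻¹) ^ (K - n)) (1 : LSite (F.P K).d → Fin (F.P K).d → (Matrix (Fin 2) (Fin 2) ℂ)ˣ) (((cubeFam false (F.P K).L a M' ρ' (K - n)) 0).indicator f) x) ∧
      (∀ (μ : ℕ → LSite (F.P K).d → (Matrix (Fin 2) (Fin 2) ℂ)), ∀ x ∈ (cubeFam false (F.P K).L a M' ρ' (K - n)) 0, qs μ x = QT (F.P K).L (K - n) (cubeLamS (F.P K).L a M' ρ' (K - n) (K - n)) (1 : LSite (F.P K).d → Fin (F.P K).d → (Matrix (Fin 2) (Fin 2) ℂ)ˣ) μ x) ∧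
      (∀ (f : LSite (F.P K).d → (Matrix (Fin 2) (Fin 2) ℂ)) (j : ℕ), j ≤ K - n → ∀ y ∈ (cubeLamS (F.P K).L a M' ρ' (K - n) (K - n)) j, q f j y = QprimeIter (zdBlocking (F.P K).d (F.P K).L) (bgT (F.P K).L (1 : LSite (F.P K).d → Fin (F.P K).d → (Matrix (Fin 2) (Fin 2) ℂ)ˣ)) j f y) ∧
      (∀ (X : XSpace (F.P K).d (K - n) (Matrix (Fin 2) (Fin 2) ℂ)) (x : LSite (F.P K).d), ‖H' X x‖ ≤ B₀'H * ‖X‖) ∧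
      (∀ j, j ≤ K - n → ∀ (X : XSpace (F.P K).d (K - n) (Matrix (Fin 2) (Fin 2) ℂ)), ∀ p ∈ {b : LSite (F.P K).d × Fin (F.P K).d | SideTouches ((cubeFam false (F.P K).L a M' ρ' (K - n)) j) b.1 b.2},
        wt (F.P K).L (((F.L : ℝ)⁻¹) ^ (K - n)) j * ‖covDerivFwd (((F.L : ℝ)⁻¹) ^ (K - n)) (1 : LSite (F.P K).d → Fin (F.P K).d → (Matrix (Fin 2) (Fin 2) ℂ)ˣ) p.2 (H' X) p.1‖ ≤ B₀'H * ‖X‖) ∧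
      (∀ X : XSpace (F.P K).d (K - n) (Matrix (Fin 2) (Fin 2) ℂ), Bd2 (F.P K).L (((F.L : ℝ)⁻¹) ^ (K - n)) (K - n) (cubeFam false (F.P K).L a M' ρ' (K - n)) (covLap (((F.L : ℝ)⁻¹) ^ (K - n)) (1 : LSite (F.P K).d → Fin (F.P K).d → (Matrix (Fin 2) (Fin 2) ℂ)ˣ) (H' X)) (B₂' * ‖X‖)) ∧
      (∀ (X : XSpace (F.P K).d (K - n) (Matrix (Fin 2) (Fin 2) ℂ)) (x : LSite (F.P K).d), x ∉ (cubeFam false (F.P K).L a M' ρ' (K - n)) 0 → H' X x = 0) ∧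
      (∀ X Y : XSpace (F.P K).d (K - n) (Matrix (Fin 2) (Fin 2) ℂ), (∀ p, Y p = -star (X p)) → ∀ x, H' Y x = -star (H' X x)) ∧
      (∀ (Y : XSpace (F.P K).d (K - n) (Matrix (Fin 2) (Fin 2) ℂ)) (j : ℕ) (hj : j ≤ K - n) (y : LSite (F.P K).d), y ∈ (cubeLamS (F.P K).L a M' ρ' (K - n) (K - n)) j →
        QprimeIter (zdBlocking (F.P K).d (F.P K).L) (bgT (F.P K).L (1 : LSite (F.P K).d → Fin (F.P K).d → (Matrix (Fin 2) (Fin 2) ℂ)ˣ)) j (H' Y) y = Y (⟨j, Nat.lt_succ_of_le hj⟩, y)) ∧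
      (∀ (f : LSite (F.P K).d → (Matrix (Fin 2) (Fin 2) ℂ)) (r : ℝ), 0 ≤ r → Bd2 (F.P K).L (((F.L : ℝ)⁻¹) ^ (K - n)) (K - n) (cubeFam false (F.P K).L a M' ρ' (K - n)) f r →
        (∀ x, ‖g f x‖ ≤ BG * r) ∧ ∀ j, j ≤ K - n → ∀ p ∈ {b : LSite (F.P K).d × Fin (F.P K).d | SideTouches ((cubeFam false (F.P K).L a M' ρ' (K - n)) j) b.1 b.2},
          wt (F.P K).L (((F.L : ℝ)⁻¹) ^ (K - n)) j * ‖covDerivFwd (((F.L : ℝ)⁻¹) ^ (K - n)) (1 : LSite (F.P K).d → Fin (F.P K).d → (Matrix (Fin 2) (Fin 2) ℂ)ˣ) p.2 (g f) p.1‖ ≤ BG * r) ∧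
      (∀ (f : LSite (F.P K).d → (Matrix (Fin 2) (Fin 2) ℂ)) (x : LSite (F.P K).d), x ∉ (cubeFam false (F.P K).L a M' ρ' (K - n)) 0 → g f x = 0) ∧
      (∀ f : LSite (F.P K).d → (Matrix (Fin 2) (Fin 2) ℂ), (∀ j, j ≤ K - n → ∀ x ∈ (cubeFam false (F.P K).L a M' ρ' (K - n)) j, IsSelfAdjoint (f x)) → ∀ x, IsSelfAdjoint (g f x)) ∧
      (∀ (f : LSite (F.P K).d → (Matrix (Fin 2) (Fin 2) ℂ)) (r : ℝ), 0 ≤ r → Bd2 (F.P K).L (((F.L : ℝ)⁻¹) ^ (K - n)) (K - n) (cubeFam false (F.P K).L a M' ρ' (K - n)) f r → Bd2 (F.P K).L (((F.L : ℝ)⁻¹) ^ (K - n)) (K - n) (cubeFam false (F.P K).L a M' ρ' (K - n)) (f - g (qs (c (q (g f))))) (BR * r)) ∧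
      (∀ f : LSite (F.P K).d → (Matrix (Fin 2) (Fin 2) ℂ), (∀ j, j ≤ K - n → ∀ x ∈ (cubeFam false (F.P K).L a M' ρ' (K - n)) j, IsSelfAdjoint (f x)) → ∀ j, j ≤ K - n → ∀ x ∈ (cubeFam false (F.P K).L a M' ρ' (K - n)) j, IsSelfAdjoint ((f - g (qs (c (q (g f))))) x)) ∧
      (∀ X : XSpace (F.P K).d (K - n) (Matrix (Fin 2) (Fin 2) ℂ), (∀ p, trCLM (Fin 2) (X p) = 0) → ∀ x, trCLM (Fin 2) (H' X x) = 0) ∧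
      (∀ f : LSite (F.P K).d → (Matrix (Fin 2) (Fin 2) ℂ), (∀ j, j ≤ K - n → ∀ x ∈ (cubeFam false (F.P K).L a M' ρ' (K - n)) j, trCLM (Fin 2) (f x) = 0) → ∀ x, trCLM (Fin 2) (g f x) = 0) ∧
      (∀ f : LSite (F.P K).d → (Matrix (Fin 2) (Fin 2) ℂ), (∀ j, j ≤ K - n → ∀ x ∈ (cubeFam false (F.P K).L a M' ρ' (K - n)) j, trCLM (Fin 2) (f x) = 0) → ∀ j, j ≤ K - n → ∀ x ∈ (cubeFam false (F.P K).L a M' ρ' (K - n)) j, trCLM (Fin 2) ((f - g (qs (c (q (g f))))) x) = 0))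
    (H59γ : ∀ (gJ : GaugeTransf (F.P K) 0 (Matrix.specialUnitaryGroup (Fin 2) ℂ)),
      InAk (F.P K).L (K - n) (((F.L : ℝ)⁻¹) ^ (K - n)) ε₀ (fun _ => (Set.univ : Set (LSite (F.P K).d))) (pull (unitsField (toUField (GaugeField.gaugeAct gJ U))) 0) →
      (∀ m', m' ≤ K - n → ∀ Λ : ℕ → Set (LSite (F.P K).d), InAx (F.P K).L m' Λ (1 : LSite (F.P K).d → Fin (F.P K).d → (Matrix (Fin 2) (Fin 2) ℂ)ˣ) (pull (unitsField (toUField (GaugeField.gaugeAct gJ U))) 0)) →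
      (∀ m', m' ≤ K - n → ∀ (x : LSite (F.P K).d) (ν : Fin (F.P K).d), tlo (F.P K).L (tLo a ρ') m' ≤ x → x + e ν ≤ thi (F.P K).L (tHi a M' ρ') m' →
        ‖((avgIter (F.P K).L (pull (unitsField (toUField (GaugeField.gaugeAct gJ U))) 0) (K - n - m') x ν : (Matrix (Fin 2) (Fin 2) ℂ)ˣ) :
            Matrix (Fin 2) (Fin 2) ℂ) - 1‖ < s) →
      ∀ (g' : GaugeTransf (F.P K) 0 (Matrix (Fin 2) (Fin 2) ℂ)ˣ) (u : LSite (F.P K).d → (Matrix (Fin 2) (Fin 2) ℂ)ˣ) (V' : LSite (F.P K).d → Fin (F.P K).d → (Matrix (Fin 2) (Fin 2) ℂ)ˣ)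
        (A' : LSite (F.P K).d → Fin (F.P K).d → (Matrix (Fin 2) (Fin 2) ℂ)),
      (∀ x, u x ∈ unitaryUnits (Matrix (Fin 2) (Fin 2) ℂ)) → (∀ x, x ∉ (cubeFam false (F.P K).L a M' ρ' (K - n)) 0 → u x = 1) →
      mgauge (1 : LSite (F.P K).d → Fin (F.P K).d → (Matrix (Fin 2) (Fin 2) ℂ)ˣ) u V' = (pull (unitsField (toUField (GaugeField.gaugeAct gJ U))) 0) →
      Restr129 (F.P K).L (K - n) (Function.update (cubeLamS (F.P K).L a M' ρ' (K - n) (K - n)) (K - n) ∅) (1 : LSite (F.P K).d → Fin (F.P K).d → (Matrix (Fin 2) (Fin 2) ℂ)ˣ) u →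
      (IsLandau138W (F.P K).L (K - n) (((F.L : ℝ)⁻¹) ^ (K - n)) ((cubeFam false (F.P K).L a M' ρ' (K - n)) 0) (cubeLamS (F.P K).L a M' ρ' (K - n) (K - n)) (1 : LSite (F.P K).d → Fin (F.P K).d → (Matrix (Fin 2) (Fin 2) ℂ)ˣ) V' ∧
        (∀ c ∈ (cubeLamBP' (F.P K).L a M' ρ' (K - n) (K - n)) (K - n), ∀ (y : LSite (F.P K).d) (τ : Fin (F.P K).d),
          InBox (loK (F.P K).L (K - n) c.1) (bondHiK (F.P K).L (K - n) c.1 c.2) y → InBox (loK (F.P K).L (K - n) c.1) (bondHiK (F.P K).L (K - n) c.1 c.2) (y + e τ) →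
          V' y τ = gaugeActT g' (unitsField (toUField U)) ⟨cover (F.P K) y, τ⟩)) →
      (∀ y τ, IsSelfAdjoint (A' y τ)) →
      (∀ j, j ≤ K - n → ∀ y τ, SideTouches ((cubeFam false (F.P K).L a M' ρ' (K - n)) j) y τ →
        V' y τ = cfgExp (((F.L : ℝ)⁻¹) ^ (K - n)) A' y τ ∧ ‖A' y τ‖ ≤ (2 * ((F.P K).L * cstar) + 8 * α₄) * (((F.P K).L : ℝ) ^ j * (((F.L : ℝ)⁻¹) ^ (K - n)))⁻¹) →
      (∀ y τ, (∀ j, j ≤ K - n → ¬ SideTouches ((cubeFam false (F.P K).L a M' ρ' (K - n)) j) y τ) → A' y τ = 0) →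
      msup (F.P K).L (K - n) (((F.L : ℝ)⁻¹) ^ (K - n)) (-(1 : ℝ)) (fun j (b : LSite (F.P K).d × Fin (F.P K).d) => SideTouches ((cubeFam false (F.P K).L a M' ρ' (K - n)) j) b.1 b.2) (fun b => A' b.1 b.2)
          ≤ B₀ * (bondNorm (F.P K).L (K - n) (((F.L : ℝ)⁻¹) ^ (K - n)) (-(3 : ℝ)) (cubeFam false (F.P K).L a M' ρ' (K - n)) (fun x μ => Jcur (((F.L : ℝ)⁻¹) ^ (K - n)) (1 : LSite (F.P K).d → Fin (F.P K).d → (Matrix (Fin 2) (Fin 2) ℂ)ˣ) A' μ x)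
            + wsup 1 (fun p : {p : ℕ × (LSite (F.P K).d × Fin (F.P K).d) // p.1 ≤ K - n ∧ (p.2 ∈ (cubeLamBP' (F.P K).L a M' ρ' (K - n) (K - n)) p.1 ∨ (p.1 = 0 ∧ CrossB ((cubeFam false (F.P K).L a M' ρ' (K - n)) 0) p.2))} =>
                linCovIter (F.P K).L (1 : LSite (F.P K).d → Fin (F.P K).d → (Matrix (Fin 2) (Fin 2) ℂ)ˣ) (iEta (((F.L : ℝ)⁻¹) ^ (K - n)) A') p.1.1 p.1.2.1 p.1.2.2))
            + Bbd * msup (F.P K).L (K - n) (((F.L : ℝ)⁻¹) ^ (K - n)) (-(1 : ℝ)) (fun j (b : LSite (F.P K).d × Fin (F.P K).d) => j = 0 ∧ SideTouches ((cubeFam false (F.P K).L a M' ρ' (K - n)) 0) b.1 b.2 ∧ ¬ BondTouches ((cubeFam false (F.P K).L a M' ρ' (K - n)) 0) b.1 b.2) (fun b => A' b.1 b.2) ∧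
        msup (F.P K).L (K - n) (((F.L : ℝ)⁻¹) ^ (K - n)) (-(2 : ℝ)) (fun j (t : Fin (F.P K).d × Fin (F.P K).d × LSite (F.P K).d) => SideTouches ((cubeFam false (F.P K).L a M' ρ' (K - n)) j) t.2.2 t.2.1)
            (fun t => covDerivFwd (((F.L : ℝ)⁻¹) ^ (K - n)) (1 : LSite (F.P K).d → Fin (F.P K).d → (Matrix (Fin 2) (Fin 2) ℂ)ˣ) t.1 (fun z => A' z t.2.1) t.2.2)
          ≤ B₀ * (bondNorm (F.P K).L (K - n) (((F.L : ℝ)⁻¹) ^ (K - n)) (-(3 : ℝ)) (cubeFam false (F.P K).L a M' ρ' (K - n)) (fun x μ => Jcur (((F.L : ℝ)⁻¹) ^ (K - n)) (1 : LSite (F.P K).d → Fin (F.P K).d → (Matrix (Fin 2) (Fin 2) ℂ)ˣ) A' μ x)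
            + wsup 1 (fun p : {p : ℕ × (LSite (F.P K).d × Fin (F.P K).d) // p.1 ≤ K - n ∧ (p.2 ∈ (cubeLamBP' (F.P K).L a M' ρ' (K - n) (K - n)) p.1 ∨ (p.1 = 0 ∧ CrossB ((cubeFam false (F.P K).L a M' ρ' (K - n)) 0) p.2))} =>
                linCovIter (F.P K).L (1 : LSite (F.P K).d → Fin (F.P K).d → (Matrix (Fin 2) (Fin 2) ℂ)ˣ) (iEta (((F.L : ℝ)⁻¹) ^ (K - n)) A') p.1.1 p.1.2.1 p.1.2.2))
            + Bbd * msup (F.P K).L (K - n) (((F.L : ℝ)⁻¹) ^ (K - n)) (-(1 : ℝ)) (fun j (b : LSite (F.P K).d × Fin (F.P K).d) => j = 0 ∧ SideTouches ((cubeFam false (F.P K).L a M' ρ' (K - n)) 0) b.1 b.2 ∧ ¬ BondTouches ((cubeFam false (F.P K).L a M' ρ' (K - n)) 0) b.1 b.2) (fun b => A' b.1 b.2))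
    (hsα₁ : s ≤ α₁) (hα₂ : 0 ≤ 2 * ((F.P K).L * cstar) + 8 * α₄) (hsmall₁ : ((F.P K).d : ℝ) * (F.P K).L * α₁ ≤ 1 / 8) (hkb : 2 * ((F.P K).L * cstar) + 8 * α₄ ≤ c4 (F.P K).d)
    (hbudget42 : 243200 * ((((F.P K).d + 2) * (F.P K).L : ℕ) : ℝ) ^ 2 * (2 * ((F.P K).L * cstar) + 8 * α₄) ≤ 1)
    {t : ℝ} (hr : Real.exp (2 * α₄) * ((Real.exp (2 * s) - 1) + α₄ * (((F.P K).L : ℝ) ^ (K - n))⁻¹) ≤ 1 / 2)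
    (hr2 : 2 * (Real.exp (2 * α₄) * ((Real.exp (2 * s) - 1) + α₄ * (((F.P K).L : ℝ) ^ (K - n))⁻¹)) ≤ (2 * ((F.P K).L * cstar) + 8 * α₄) * (((F.P K).L : ℝ) ^ (K - n))⁻¹)
    (hwin : t + (C2 (F.P K).d + 64 * 60800 * ((((F.P K).d + 2) * (F.P K).L : ℕ) : ℝ) ^ 2) * (2 * ((F.P K).L * cstar) + 8 * α₄) ^ 2 <
      2 * ((F.P K).d : ℝ) * (F.P K).L * α₁)
    (HTOP : ∀ (gJ : GaugeTransf (F.P K) 0 (Matrix.specialUnitaryGroup (Fin 2) ℂ)) (u₁ : LSite (F.P K).d → (Matrix (Fin 2) (Fin 2) ℂ)ˣ)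
        (W : LSite (F.P K).d → Fin (F.P K).d → (Matrix (Fin 2) (Fin 2) ℂ)ˣ) (A : LSite (F.P K).d → Fin (F.P K).d → Matrix (Fin 2) (Fin 2) ℂ) (c₁ c' : ℝ)
        (κf : (Site (F.P K) 0 → Matrix (Fin 2) (Fin 2) ℂ) → (i : ℕ) → GaugeTransf (F.P K) i (Matrix (Fin 2) (Fin 2) ℂ)ˣ) (lam : LSite (F.P K).d → Matrix (Fin 2) (Fin 2) ℂ),
      (∀ z, ((u₁ z : (Matrix (Fin 2) (Fin 2) ℂ)ˣ) : Matrix (Fin 2) (Fin 2) ℂ) ∈ Matrix.specialUnitaryGroup (Fin 2) ℂ) →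
      mgauge (1 : LSite (F.P K).d → Fin (F.P K).d → (Matrix (Fin 2) (Fin 2) ℂ)ˣ) u₁ W = pull (unitsField (toUField (GaugeField.gaugeAct gJ U))) 0 →
      0 ≤ c' → 8 * 3800 * ((((F.P K).d + 2) * (F.P K).L : ℕ) : ℝ) ^ 2 * c' ≤ 1 → Real.exp c₁ - 1 ≤ ((F.L : ℝ)⁻¹) ^ (K - n) * c' →
      (∀ z ∈ cube (F.P K).L a M' ρ' (K - n) (K - n), ∀ ν : Fin (F.P K).d, W z ν = cfgExp (((F.L : ℝ)⁻¹) ^ (K - n)) A z ν ∧ ((F.L : ℝ)⁻¹) ^ (K - n) * ‖A z ν‖ ≤ c₁) →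
      (∀ (m : Site (F.P K) 0 → Matrix (Fin 2) (Fin 2) ℂ) (i : ℕ) (y : Site (F.P K) (i + 1)),
        κf m (i + 1) y = (vframeU (gaugeActT (κf m i) (dbarIterU i (gaugeActT (fun s => (u₁ (lift (F.P K) x₀ + rel x₀ s))⁻¹ * Unitary.toUnits (suIncl (gJ s)) : GaugeTransf (F.P K) 0 (Matrix (Fin 2) (Fin 2) ℂ)ˣ) (unitsField (toUField U))))) y)⁻¹ * κf m i (emb y) * vframeU (dbarIterU i (gaugeActT (fun s => (u₁ (lift (F.P K) x₀ + rel x₀ s))⁻¹ * Unitary.toUnits (suIncl (gJ s)) : GaugeTransf (F.P K) 0 (Matrix (Fin 2) (Fin 2) ℂ)ˣ) (unitsField (toUField U)))) y) →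
      (∀ (m : Site (F.P K) 0 → Matrix (Fin 2) (Fin 2) ℂ) (x : Site (F.P K) 0), ((κf m 0 x : (Matrix (Fin 2) (Fin 2) ℂ)ˣ) : Matrix (Fin 2) (Fin 2) ℂ) = exp (m x)) →
      (∀ x, IsSelfAdjoint (lam x)) → (∀ x, (lam x).trace = 0) →
      (∀ yc ∈ cubeLamS (F.P K).L a M' ρ' (K - n) (K - n) (K - n),
        κf (((-I) • lam) ∘ fun s : Site (F.P K) 0 => lift (F.P K) x₀ + rel x₀ s) (K - n) (coverAt (F.P K) (K - n) yc) =
          axialT (dbarIterU (K - n) (gaugeActT (fun s => (u₁ (lift (F.P K) x₀ + rel x₀ s))⁻¹ * Unitary.toUnits (suIncl (gJ s)) : GaugeTransf (F.P K) 0 (Matrix (Fin 2) (Fin 2) ℂ)ˣ) (unitsField (toUField U)))) (iterBlockOf (K - n) x₀) (coverAt (F.P K) (K - n) yc)) →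
      ∀ c ∈ (cubeLamB (F.P K).L a M' ρ' (K - n) (K - n)) (K - n),
        ‖mlog ((dbarIterU (K - n) (gaugeActT (fun s => ((u₁ * gaugeExp lam) (lift (F.P K) x₀ + rel x₀ s))⁻¹ * Unitary.toUnits (suIncl (gJ s)) :
            GaugeTransf (F.P K) 0 (Matrix (Fin 2) (Fin 2) ℂ)ˣ) (unitsField (toUField U)))
            ⟨coverAt (F.P K) (K - n) c.1, c.2⟩ : (Matrix (Fin 2) (Fin 2) ℂ)ˣ) : Matrix (Fin 2) (Fin 2) ℂ)‖ ≤ t)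
    -- SOCKET `H42topCrossT` (v3.1, DATUM-CLOSED; ★w3-19200 g9's letters VERBATIM): (1.42) on the level-`k` COLLAR bonds of print's class at the knit gauge OF THE DATUM — ∀ gJ (guards), datum + top objects WITH rows, then ∀ (u, V′, A′)
    (H42topCrossT : ∀ (gJ : GaugeTransf (F.P K) 0 (Matrix.specialUnitaryGroup (Fin 2) ℂ)) (u₁ : LSite (F.P K).d → (Matrix (Fin 2) (Fin 2) ℂ)ˣ)
        (W : LSite (F.P K).d → Fin (F.P K).d → (Matrix (Fin 2) (Fin 2) ℂ)ˣ) (A : LSite (F.P K).d → Fin (F.P K).d → Matrix (Fin 2) (Fin 2) ℂ) (c₁ c' : ℝ)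
        (κf : (Site (F.P K) 0 → Matrix (Fin 2) (Fin 2) ℂ) → (i : ℕ) → GaugeTransf (F.P K) i (Matrix (Fin 2) (Fin 2) ℂ)ˣ) (lam : LSite (F.P K).d → Matrix (Fin 2) (Fin 2) ℂ),
      InAk (F.P K).L (K - n) (((F.L : ℝ)⁻¹) ^ (K - n)) ε₀ (fun _ => (Set.univ : Set (LSite (F.P K).d))) (pull (unitsField (toUField (GaugeField.gaugeAct gJ U))) 0) →
      (∀ m', m' ≤ K - n → ∀ Λ : ℕ → Set (LSite (F.P K).d), InAx (F.P K).L m' Λ (1 : LSite (F.P K).d → Fin (F.P K).d → (Matrix (Fin 2) (Fin 2) ℂ)ˣ) (pull (unitsField (toUField (GaugeField.gaugeAct gJ U))) 0)) →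
      (∀ m', m' ≤ K - n → ∀ (x : LSite (F.P K).d) (ν : Fin (F.P K).d), tlo (F.P K).L (tLo a ρ') m' ≤ x → x + e ν ≤ thi (F.P K).L (tHi a M' ρ') m' →
        ‖((avgIter (F.P K).L (pull (unitsField (toUField (GaugeField.gaugeAct gJ U))) 0) (K - n - m') x ν : (Matrix (Fin 2) (Fin 2) ℂ)ˣ) : Matrix (Fin 2) (Fin 2) ℂ) - 1‖ < s) →
      (∀ z, ((u₁ z : (Matrix (Fin 2) (Fin 2) ℂ)ˣ) : Matrix (Fin 2) (Fin 2) ℂ) ∈ Matrix.specialUnitaryGroup (Fin 2) ℂ) →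
      mgauge (1 : LSite (F.P K).d → Fin (F.P K).d → (Matrix (Fin 2) (Fin 2) ℂ)ˣ) u₁ W = pull (unitsField (toUField (GaugeField.gaugeAct gJ U))) 0 →
      0 ≤ c' → 8 * 3800 * ((((F.P K).d + 2) * (F.P K).L : ℕ) : ℝ) ^ 2 * c' ≤ 1 → Real.exp c₁ - 1 ≤ ((F.L : ℝ)⁻¹) ^ (K - n) * c' →
      (∀ z ∈ cube (F.P K).L a M' ρ' (K - n) (K - n), ∀ ν : Fin (F.P K).d, W z ν = cfgExp (((F.L : ℝ)⁻¹) ^ (K - n)) A z ν ∧ ((F.L : ℝ)⁻¹) ^ (K - n) * ‖A z ν‖ ≤ c₁) →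
      (∀ (m : Site (F.P K) 0 → Matrix (Fin 2) (Fin 2) ℂ) (i : ℕ) (y : Site (F.P K) (i + 1)), κf m (i + 1) y = (vframeU (gaugeActT (κf m i) (dbarIterU i (gaugeActT
          (fun s => (u₁ (lift (F.P K) x₀ + rel x₀ s))⁻¹ * Unitary.toUnits (suIncl (gJ s)) : GaugeTransf (F.P K) 0 (Matrix (Fin 2) (Fin 2) ℂ)ˣ)
          (unitsField (toUField U))))) y)⁻¹ * κf m i (emb y) * vframeU (dbarIterU i (gaugeActT
            (fun s => (u₁ (lift (F.P K) x₀ + rel x₀ s))⁻¹ * Unitary.toUnits (suIncl (gJ s)) : GaugeTransf (F.P K) 0 (Matrix (Fin 2) (Fin 2) ℂ)ˣ) (unitsField (toUField U)))) y) →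
      (∀ (m : Site (F.P K) 0 → Matrix (Fin 2) (Fin 2) ℂ) (x : Site (F.P K) 0), ((κf m 0 x : (Matrix (Fin 2) (Fin 2) ℂ)ˣ) : Matrix (Fin 2) (Fin 2) ℂ) = exp (m x)) →
      (∀ x, IsSelfAdjoint (lam x)) → (∀ x, (lam x).trace = 0) → (∀ yc ∈ cubeLamS (F.P K).L a M' ρ' (K - n) (K - n) (K - n),
        κf (((-I) • lam) ∘ fun s : Site (F.P K) 0 => lift (F.P K) x₀ + rel x₀ s) (K - n) (coverAt (F.P K) (K - n) yc) = axialT (dbarIterU (K - n) (gaugeActT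
            (fun s => (u₁ (lift (F.P K) x₀ + rel x₀ s))⁻¹ * Unitary.toUnits (suIncl (gJ s)) : GaugeTransf (F.P K) 0 (Matrix (Fin 2) (Fin 2) ℂ)ˣ)
            (unitsField (toUField U)))) (iterBlockOf (K - n) x₀) (coverAt (F.P K) (K - n) yc)) →
      (∀ j, j ≤ K - n → ∀ b ∈ {b : LSite (F.P K).d × Fin (F.P K).d | SideTouches ((cubeFam false (F.P K).L a M' ρ' (K - n)) j) b.1 b.2},
        ‖lam b.1‖ ≤ α₄ ∧ wt (F.P K).L (((F.L : ℝ)⁻¹) ^ (K - n)) j * ‖covDerivFwd (((F.L : ℝ)⁻¹) ^ (K - n)) (1 : LSite (F.P K).d → Fin (F.P K).d → (Matrix (Fin 2) (Fin 2) ℂ)ˣ) b.2 lam b.1‖ ≤ α₄) →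
      ∀ (u : LSite (F.P K).d → (Matrix (Fin 2) (Fin 2) ℂ)ˣ) (V' : LSite (F.P K).d → Fin (F.P K).d → (Matrix (Fin 2) (Fin 2) ℂ)ˣ) (A' : LSite (F.P K).d → Fin (F.P K).d → (Matrix (Fin 2) (Fin 2) ℂ)),
      (∀ x, u x ∈ unitaryUnits (Matrix (Fin 2) (Fin 2) ℂ)) → mgauge (1 : LSite (F.P K).d → Fin (F.P K).d → (Matrix (Fin 2) (Fin 2) ℂ)ˣ) u V' = (pull (unitsField (toUField (GaugeField.gaugeAct gJ U))) 0) →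
      Restr129 (F.P K).L (K - n) (Function.update (cubeLamS (F.P K).L a M' ρ' (K - n) (K - n)) (K - n) ∅) (1 : LSite (F.P K).d → Fin (F.P K).d → (Matrix (Fin 2) (Fin 2) ℂ)ˣ) u →
      (IsLandau138W (F.P K).L (K - n) (((F.L : ℝ)⁻¹) ^ (K - n)) ((cubeFam false (F.P K).L a M' ρ' (K - n)) 0) (cubeLamS (F.P K).L a M' ρ' (K - n) (K - n)) (1 : LSite (F.P K).d → Fin (F.P K).d → (Matrix (Fin 2) (Fin 2) ℂ)ˣ) V' ∧
        (∀ c ∈ (cubeLamBP' (F.P K).L a M' ρ' (K - n) (K - n)) (K - n), ∀ (y : LSite (F.P K).d) (τ : Fin (F.P K).d),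
          InBox (loK (F.P K).L (K - n) c.1) (bondHiK (F.P K).L (K - n) c.1 c.2) y → InBox (loK (F.P K).L (K - n) c.1) (bondHiK (F.P K).L (K - n) c.1 c.2) (y + e τ) →
          V' y τ = gaugeActT (fun s => ((u₁ * gaugeExp lam) (lift (F.P K) x₀ + rel x₀ s))⁻¹ * Unitary.toUnits (suIncl (gJ s)) : GaugeTransf (F.P K) 0 (Matrix (Fin 2) (Fin 2) ℂ)ˣ) (unitsField (toUField U)) ⟨cover (F.P K) y, τ⟩)) →
      (∀ y τ, IsSelfAdjoint (A' y τ)) → (∀ j, j ≤ K - n → ∀ y τ, SideTouches ((cubeFam false (F.P K).L a M' ρ' (K - n)) j) y τ →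
        V' y τ = cfgExp (((F.L : ℝ)⁻¹) ^ (K - n)) A' y τ ∧ ‖A' y τ‖ ≤ (2 * ((F.P K).L * cstar) + 8 * α₄) * (((F.P K).L : ℝ) ^ j * (((F.L : ℝ)⁻¹) ^ (K - n)))⁻¹) →
      (∀ y τ, (∀ j, j ≤ K - n → ¬ SideTouches ((cubeFam false (F.P K).L a M' ρ' (K - n)) j) y τ) → A' y τ = 0) →
      ∀ c ∈ (cubeLamBP' (F.P K).L a M' ρ' (K - n) (K - n)) (K - n), c ∉ (cubeLamB (F.P K).L a M' ρ' (K - n) (K - n)) (K - n) →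
        ‖logCovIter (F.P K).L (1 : LSite (F.P K).d → Fin (F.P K).d → (Matrix (Fin 2) (Fin 2) ℂ)ˣ) (iEta (((F.L : ℝ)⁻¹) ^ (K - n)) A') (K - n) c.1 c.2‖ < 2 * (F.P K).d * (F.P K).L * α₁)
    (hTorus : ∀ (gJ : GaugeTransf (F.P K) 0 (Matrix.specialUnitaryGroup (Fin 2) ℂ)),
      (∀ (x : LSite (F.P K).d) (ν : Fin (F.P K).d), tlo (F.P K).L (tLo a ρ') (K - n) ≤ x → x + e ν ≤ thi (F.P K).L (tHi a M' ρ') (K - n) →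
        ‖(((pull (unitsField (toUField (GaugeField.gaugeAct gJ U))) 0) x ν : (Matrix (Fin 2) (Fin 2) ℂ)ˣ) : (Matrix (Fin 2) (Fin 2) ℂ)) - 1‖ < s) →
      ∀ (κf : (Site (F.P K) 0 → (Matrix (Fin 2) (Fin 2) ℂ)) → (i : ℕ) → GaugeTransf (F.P K) i (Matrix (Fin 2) (Fin 2) ℂ)ˣ),
      (∀ (m : Site (F.P K) 0 → (Matrix (Fin 2) (Fin 2) ℂ)) (i : ℕ) (y : Site (F.P K) (i + 1)),
        κf m (i + 1) y = (vframeU (gaugeActT (κf m i) (dbarIterU i (gaugeActT (fun s => ((1 : LSite (F.P K).d → (Matrix (Fin 2) (Fin 2) ℂ)ˣ) (lift (F.P K) x₀ + rel x₀ s))⁻¹ * Unitary.toUnits (suIncl (gJ s)) : GaugeTransf (F.P K) 0 (Matrix (Fin 2) (Fin 2) ℂ)ˣ) (unitsField (toUField U))))) y)⁻¹ * κf m i (emb y) * vframeU (dbarIterU i (gaugeActT (fun s => ((1 : LSite (F.P K).d → (Matrix (Fin 2) (Fin 2) ℂ)ˣ) (lift (F.P K) x₀ + rel x₀ s))⁻¹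 * Unitary.toUnits (suIncl (gJ s)) : GaugeTransf (F.P K) 0 (Matrix (Fin 2) (Fin 2) ℂ)ˣ) (unitsField (toUField U)))) y) →
      (∀ (m : Site (F.P K) 0 → (Matrix (Fin 2) (Fin 2) ℂ)) (x : Site (F.P K) 0), ((κf m 0 x : (Matrix (Fin 2) (Fin 2) ℂ)ˣ) : (Matrix (Fin 2) (Fin 2) ℂ)) = exp (m x)) →
      ∃ th : XSpace (F.P K).d (K - n) (Matrix (Fin 2) (Fin 2) ℂ),
        B₀'H * ‖th‖ < α₄ / 4 ∧ (∀ p, star (th p) = -th p) ∧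
        (∀ yc ∈ (cubeLamS (F.P K).L a M' ρ' (K - n) (K - n)) (K - n), th (⟨K - n, Nat.lt_succ_self (K - n)⟩, yc) =
          mlog ((axialT (dbarIterU (K - n) (gaugeActT (fun s => ((1 : LSite (F.P K).d → (Matrix (Fin 2) (Fin 2) ℂ)ˣ) (lift (F.P K) x₀ + rel x₀ s))⁻¹ * Unitary.toUnits (suIncl (gJ s)) : GaugeTransf (F.P K) 0 (Matrix (Fin 2) (Fin 2) ℂ)ˣ) (unitsField (toUField U)))) (iterBlockOf (K - n) x₀) (coverAt (F.P K) (K - n) yc) : (Matrix (Fin 2) (Fin 2) ℂ)ˣ) : (Matrix (Fin 2) (Fin 2) ℂ))) ∧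
        (∀ (j : ℕ) (hj : j < K - n) (y : LSite (F.P K).d), y ∈ (cubeLamS (F.P K).L a M' ρ' (K - n) (K - n)) j → th (⟨j, Nat.lt_succ_of_lt hj⟩, y) = 0) ∧
        (∀ yc ∈ (cubeLamS (F.P K).L a M' ρ' (K - n) (K - n)) (K - n), ‖((axialT (dbarIterU (K - n) (gaugeActT (fun s => ((1 : LSite (F.P K).d → (Matrix (Fin 2) (Fin 2) ℂ)ˣ) (lift (F.P K) x₀ + rel x₀ s))⁻¹ * Unitary.toUnits (suIncl (gJ s)) : GaugeTransf (F.P K) 0 (Matrix (Fin 2) (Fin 2) ℂ)ˣ) (unitsField (toUField U)))) (iterBlockOf (K - n) x₀) (coverAt (F.P K) (K - n) yc) : (Matrix (Fin 2) (Fin 2) ℂ)ˣ) : (Matrix (Fin 2) (Fin 2) ℂ)) - 1‖ < 1) ∧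
        (∀ p, trCLM (Fin 2) (th p) = 0) ∧
        (α₄ / 4 + B₀'H * (Cb + ‖th‖) ≤ 1 / 24) ∧ (α₄ / 4 + B₀'H * (Cb + ‖th‖) ≤ 1 / 140) ∧
        (10 * (α₄ / 4 + B₀'H * (Cb + ‖th‖)) * BR ≤ 1 / 2) ∧ (B₀'H * (Cb + ‖th‖) ≤ 3 * α₄ / 4) ∧
        (BG * Mc (F.P K).d BR (α₄ / 4 + B₀'H * (Cb + ‖th‖)) cA (B₂' * (Cb + ‖th‖)) cDA ≤ α₄ / 4) ∧
        (BG * Kc (F.P K).d BR (α₄ / 4 + B₀'H * (Cb + ‖th‖)) cA (B₂' * (Cb + ‖th‖)) cDA (B₂' * (2 * Cl)) (1 + B₀'H * (2 * Cl)) (1 + B₀'H * (2 * Cl)) ≤ 1 / 2) ∧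
        (∀ yc ∈ (cubeLamS (F.P K).L a M' ρ' (K - n) (K - n)) (K - n), ∀ l₀ : Site (F.P K) 0 → (Matrix (Fin 2) (Fin 2) ℂ),
          (∀ x : LSite (F.P K).d, InBox (tlo (F.P K).L yc (K - n)) (thi (F.P K).L yc (K - n)) x → ‖l₀ (cover (F.P K) x)‖ ≤ α₄) →
          (∀ (x : LSite (F.P K).d) (κ : Fin (F.P K).d), InBox (tlo (F.P K).L yc (K - n)) (thi (F.P K).L yc (K - n)) x →
            InBox (tlo (F.P K).L yc (K - n)) (thi (F.P K).L yc (K - n)) (x + e κ) → ‖l₀ (cover (F.P K) (x + e κ)) - l₀ (cover (F.P K) x)‖ ≤ α₄ * (((F.P K).L : ℝ) ^ (K - n))⁻¹) →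
          exp (mlog ((κf l₀ (K - n) (coverAt (F.P K) (K - n) yc) : (Matrix (Fin 2) (Fin 2) ℂ)ˣ) : (Matrix (Fin 2) (Fin 2) ℂ))) = ((κf l₀ (K - n) (coverAt (F.P K) (K - n) yc) : (Matrix (Fin 2) (Fin 2) ℂ)ˣ) : (Matrix (Fin 2) (Fin 2) ℂ)) ∧
            ‖mlog ((κf l₀ (K - n) (coverAt (F.P K) (K - n) yc) : (Matrix (Fin 2) (Fin 2) ℂ)ˣ) : (Matrix (Fin 2) (Fin 2) ℂ)) - siteAvgIter (K - n) l₀ (coverAt (F.P K) (K - n) yc)‖ ≤ Cb) ∧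
        (∀ yc ∈ (cubeLamS (F.P K).L a M' ρ' (K - n) (K - n)) (K - n), ∀ (l₁ l₂ : Site (F.P K) 0 → (Matrix (Fin 2) (Fin 2) ℂ)) (r : ℝ), 0 ≤ r →
          (∀ x : LSite (F.P K).d, InBox (tlo (F.P K).L yc (K - n)) (thi (F.P K).L yc (K - n)) x → ‖l₁ (cover (F.P K) x)‖ ≤ α₄) →
          (∀ (x : LSite (F.P K).d) (κ : Fin (F.P K).d), InBox (tlo (F.P K).L yc (K - n)) (thi (F.P K).L yc (K - n)) x →
            InBox (tlo (F.P K).L yc (K - n)) (thi (F.P K).L yc (K - n)) (x + e κ) → ‖l₁ (cover (F.P K) (x + e κ)) - l₁ (cover (F.P K) x)‖ ≤ α₄ * (((F.P K).L : ℝ) ^ (K - n))⁻¹) →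
          (∀ x : LSite (F.P K).d, InBox (tlo (F.P K).L yc (K - n)) (thi (F.P K).L yc (K - n)) x → ‖l₂ (cover (F.P K) x)‖ ≤ α₄) →
          (∀ (x : LSite (F.P K).d) (κ : Fin (F.P K).d), InBox (tlo (F.P K).L yc (K - n)) (thi (F.P K).L yc (K - n)) x →
            InBox (tlo (F.P K).L yc (K - n)) (thi (F.P K).L yc (K - n)) (x + e κ) → ‖l₂ (cover (F.P K) (x + e κ)) - l₂ (cover (F.P K) x)‖ ≤ α₄ * (((F.P K).L : ℝ) ^ (K - n))⁻¹) →
          (∀ x : LSite (F.P K).d, InBox (tlo (F.P K).L yc (K - n)) (thi (F.P K).L yc (K - n)) x → ‖l₁ (cover (F.P K) x) - l₂ (cover (F.P K) x)‖ ≤ r) →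
          (∀ (x : LSite (F.P K).d) (κ : Fin (F.P K).d), InBox (tlo (F.P K).L yc (K - n)) (thi (F.P K).L yc (K - n)) x →
            InBox (tlo (F.P K).L yc (K - n)) (thi (F.P K).L yc (K - n)) (x + e κ) →
            ‖(l₁ (cover (F.P K) (x + e κ)) - l₂ (cover (F.P K) (x + e κ))) - (l₁ (cover (F.P K) x) - l₂ (cover (F.P K) x))‖ ≤ r * (((F.P K).L : ℝ) ^ (K - n))⁻¹) →
          ‖(mlog ((κf l₁ (K - n) (coverAt (F.P K) (K - n) yc) : (Matrix (Fin 2) (Fin 2) ℂ)ˣ) : (Matrix (Fin 2) (Fin 2) ℂ)) - siteAvgIter (K - n) l₁ (coverAt (F.P K) (K - n) yc)) -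
              (mlog ((κf l₂ (K - n) (coverAt (F.P K) (K - n) yc) : (Matrix (Fin 2) (Fin 2) ℂ)ˣ) : (Matrix (Fin 2) (Fin 2) ℂ)) - siteAvgIter (K - n) l₂ (coverAt (F.P K) (K - n) yc))‖ ≤ Cl * r) ∧
        (∀ yc ∈ (cubeLamS (F.P K).L a M' ρ' (K - n) (K - n)) (K - n), ∀ l₀ : Site (F.P K) 0 → (Matrix (Fin 2) (Fin 2) ℂ),
          (∀ x : LSite (F.P K).d, InBox (tlo (F.P K).L yc (K - n)) (thi (F.P K).L yc (K - n)) x → ‖l₀ (cover (F.P K) x)‖ ≤ α₄) →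
          (∀ (x : LSite (F.P K).d) (κ : Fin (F.P K).d), InBox (tlo (F.P K).L yc (K - n)) (thi (F.P K).L yc (K - n)) x →
            InBox (tlo (F.P K).L yc (K - n)) (thi (F.P K).L yc (K - n)) (x + e κ) → ‖l₀ (cover (F.P K) (x + e κ)) - l₀ (cover (F.P K) x)‖ ≤ α₄ * (((F.P K).L : ℝ) ^ (K - n))⁻¹) →
          mlog ((κf (fun s => -star (l₀ s)) (K - n) (coverAt (F.P K) (K - n) yc) : (Matrix (Fin 2) (Fin 2) ℂ)ˣ) : (Matrix (Fin 2) (Fin 2) ℂ)) - siteAvgIter (K - n) (fun s => -star (l₀ s)) (coverAt (F.P K) (K - n) yc) =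
            -star (mlog ((κf l₀ (K - n) (coverAt (F.P K) (K - n) yc) : (Matrix (Fin 2) (Fin 2) ℂ)ˣ) : (Matrix (Fin 2) (Fin 2) ℂ)) - siteAvgIter (K - n) l₀ (coverAt (F.P K) (K - n) yc))) ∧
        (∀ yc ∈ (cubeLamS (F.P K).L a M' ρ' (K - n) (K - n)) (K - n), ∀ l₀ : Site (F.P K) 0 → (Matrix (Fin 2) (Fin 2) ℂ), (∀ s, trCLM (Fin 2) (l₀ s) = 0) →
          (∀ x : LSite (F.P K).d, InBox (tlo (F.P K).L yc (K - n)) (thi (F.P K).L yc (K - n)) x → ‖l₀ (cover (F.P K) x)‖ ≤ α₄) →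
          (∀ (x : LSite (F.P K).d) (κ : Fin (F.P K).d), InBox (tlo (F.P K).L yc (K - n)) (thi (F.P K).L yc (K - n)) x →
            InBox (tlo (F.P K).L yc (K - n)) (thi (F.P K).L yc (K - n)) (x + e κ) → ‖l₀ (cover (F.P K) (x + e κ)) - l₀ (cover (F.P K) x)‖ ≤ α₄ * (((F.P K).L : ℝ) ^ (K - n))⁻¹) →
          trCLM (Fin 2) (mlog ((κf l₀ (K - n) (coverAt (F.P K) (K - n) yc) : (Matrix (Fin 2) (Fin 2) ℂ)ˣ) : (Matrix (Fin 2) (Fin 2) ℂ)) - siteAvgIter (K - n) l₀ (coverAt (F.P K) (K - n) yc)) = 0)) :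
              ∃ (t : ℤ) (_ : 0 ≤ t) (_ : t ≤ (M' : ℤ) - 1)
                (gJ : GaugeTransf (F.P K) 0 (Matrix.specialUnitaryGroup (Fin 2) ℂ))
                (u₁ : LSite (F.P K).d → (Matrix (Fin 2) (Fin 2) ℂ)ˣ)
                (W : LSite (F.P K).d → Fin (F.P K).d → (Matrix (Fin 2) (Fin 2) ℂ)ˣ)
                (A : LSite (F.P K).d → Fin (F.P K).d → Matrix (Fin 2) (Fin 2) ℂ)
                (c₁ c' : ℝ)
                (κf : (Site (F.P K) 0 → Matrix (Fin 2) (Fin 2) ℂ) → (i : ℕ) → GaugeTransf (F.P K) i (Matrix (Fin 2) (Fin 2) ℂ)ˣ)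
                (lam : LSite (F.P K).d → Matrix (Fin 2) (Fin 2) ℂ)
                (α₄ cA : ℝ),
                (∀ z, ((u₁ z : (Matrix (Fin 2) (Fin 2) ℂ)ˣ) : Matrix (Fin 2) (Fin 2) ℂ) ∈ Matrix.specialUnitaryGroup (Fin 2) ℂ) ∧
                (mgauge (1 : LSite (F.P K).d → Fin (F.P K).d → (Matrix (Fin 2) (Fin 2) ℂ)ˣ) u₁ W = pull (unitsField (toUField (GaugeField.gaugeAct gJ U))) 0) ∧
                (∀ b ∈ {b : LSite (F.P K).d × Fin (F.P K).d | SideTouches (cubeFam false (F.P K).L (fun μ => ((iterBlockOf (K - n) x₀ μ).val : ℤ) - t₀) M' (ρ + M + L + S) (K - n) 0) b.1 b.2},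
      W b.1 b.2 = cfgExp (((F.L : ℝ)⁻¹) ^ (K - n)) A b.1 b.2) ∧
                (0 ≤ c') ∧
                (8 * 3800 * ((((F.P K).d + 2) * (F.P K).L : ℕ) : ℝ) ^ 2 * c' ≤ 1) ∧
                (Real.exp c₁ - 1 ≤ ((F.L : ℝ)⁻¹) ^ (K - n) * c') ∧
                (∀ z ∈ cube (F.P K).L (fun μ => ((iterBlockOf (K - n) x₀ μ).val : ℤ) - t₀) M' (ρ + M + L + S) (K - n) (K - n), ∀ ν : Fin (F.P K).d,
      W z ν = cfgExp (((F.L : ℝ)⁻¹) ^ (K - n)) A z ν ∧ ((F.L : ℝ)⁻¹) ^ (K - n) * ‖A z ν‖ ≤ c₁) ∧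
                (∀ (m : Site (F.P K) 0 → Matrix (Fin 2) (Fin 2) ℂ) (i : ℕ) (y : Site (F.P K) (i + 1)),
      κf m (i + 1) y = (vframeU (gaugeActT (κf m i) (dbarIterU i (gaugeActT
        (fun s => (u₁ (lift (F.P K) x₀ + rel x₀ s))⁻¹ * Unitary.toUnits (suIncl (gJ s)) : GaugeTransf (F.P K) 0 (Matrix (Fin 2) (Fin 2) ℂ)ˣ)
        (unitsField (toUField U))))) y)⁻¹ * κf m i (emb y) *
        vframeU (dbarIterU i (gaugeActT
          (fun s => (u₁ (lift (F.P K) x₀ + rel x₀ s))⁻¹ * Unitary.toUnits (suIncl (gJ s)) : GaugeTransf (F.P K) 0 (Matrix (Fin 2) (Fin 2) ℂ)ˣ)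
          (unitsField (toUField U)))) y) ∧
                (∀ (m : Site (F.P K) 0 → Matrix (Fin 2) (Fin 2) ℂ) (x : Site (F.P K) 0), ((κf m 0 x : (Matrix (Fin 2) (Fin 2) ℂ)ˣ) : Matrix (Fin 2) (Fin 2) ℂ) = exp (m x)) ∧
                (0 ≤ α₄) ∧
                (α₄ ≤ 1 / 70) ∧
                (0 ≤ cA) ∧
                (cA ≤ 1 / 12) ∧
                (∀ x, IsSelfAdjoint (lam x)) ∧
                (∀ x, (lam x).trace = 0) ∧
                (∀ x, x ∉ cubeFam false (F.P K).L (fun μ => ((iterBlockOf (K - n) x₀ μ).val : ℤ) - t₀) M' (ρ + M + L + S) (K - n) 0 → lam x = 0) ∧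
                (∀ b ∈ {b : LSite (F.P K).d × Fin (F.P K).d | SideTouches (cubeFam false (F.P K).L (fun μ => ((iterBlockOf (K - n) x₀ μ).val : ℤ) - t₀) M' (ρ + M + L + S) (K - n) 0) b.1 b.2},
      ‖lam b.1‖ ≤ α₄ ∧ wt (F.P K).L (((F.L : ℝ)⁻¹) ^ (K - n)) 0 *
        ‖covDerivFwd (((F.L : ℝ)⁻¹) ^ (K - n)) (1 : LSite (F.P K).d → Fin (F.P K).d → (Matrix (Fin 2) (Fin 2) ℂ)ˣ) b.2 lam b.1‖ ≤ α₄) ∧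
                (∃ μ : ℕ → LSite (F.P K).d → Matrix (Fin 2) (Fin 2) ℂ, ∀ x ∈ cubeFam false (F.P K).L (fun μ => ((iterBlockOf (K - n) x₀ μ).val : ℤ) - t₀) M' (ρ + M + L + S) (K - n) 0,
      covLap (((F.L : ℝ)⁻¹) ^ (K - n)) (1 : LSite (F.P K).d → Fin (F.P K).d → (Matrix (Fin 2) (Fin 2) ℂ)ˣ)
        ((cubeFam false (F.P K).L (fun μ => ((iterBlockOf (K - n) x₀ μ).val : ℤ) - t₀) M' (ρ + M + L + S) (K - n) 0).indicator fun y =>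
          covDivB (((F.L : ℝ)⁻¹) ^ (K - n)) (1 : LSite (F.P K).d → Fin (F.P K).d → (Matrix (Fin 2) (Fin 2) ℂ)ˣ) A y +
          covLap (((F.L : ℝ)⁻¹) ^ (K - n)) (1 : LSite (F.P K).d → Fin (F.P K).d → (Matrix (Fin 2) (Fin 2) ℂ)ˣ) lam y +
          ((conjR (gaugeExp lam y)⁻¹ (covDivB (((F.L : ℝ)⁻¹) ^ (K - n)) (1 : LSite (F.P K).d → Fin (F.P K).d → (Matrix (Fin 2) (Fin 2) ℂ)ˣ) A y) -
              covDivB (((F.L : ℝ)⁻¹) ^ (K - n)) (1 : LSite (F.P K).d → Fin (F.P K).d → (Matrix (Fin 2) (Fin 2) ℂ)ˣ) A y) +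
            (gAd (covLap (((F.L : ℝ)⁻¹) ^ (K - n)) (1 : LSite (F.P K).d → Fin (F.P K).d → (Matrix (Fin 2) (Fin 2) ℂ)ˣ) lam y) (lam y) -
              covLap (((F.L : ℝ)⁻¹) ^ (K - n)) (1 : LSite (F.P K).d → Fin (F.P K).d → (Matrix (Fin 2) (Fin 2) ℂ)ˣ) lam y) +
            ∑ μ, frakF3 (((F.L : ℝ)⁻¹) ^ (K - n)) (1 : LSite (F.P K).d → Fin (F.P K).d → (Matrix (Fin 2) (Fin 2) ℂ)ˣ) lam A y μ)) x =
        QT (F.P K).L (K - n) (cubeLamS (F.P K).L (fun μ => ((iterBlockOf (K - n) x₀ μ).val : ℤ) - t₀) M' (ρ + M + L + S) (K - n) (K - n)) (1 : LSite (F.P K).d → Fin (F.P K).d → (Matrix (Fin 2) (Fin 2) ℂ)ˣ) μ x) ∧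
                (∀ yc ∈ cubeLamS (F.P K).L (fun μ => ((iterBlockOf (K - n) x₀ μ).val : ℤ) - t₀) M' (ρ + M + L + S) (K - n) (K - n) (K - n),
      κf (((-I) • lam) ∘ fun s : Site (F.P K) 0 => lift (F.P K) x₀ + rel x₀ s) (K - n) (coverAt (F.P K) (K - n) yc) =
        axialT (dbarIterU (K - n) (gaugeActT
          (fun s => (u₁ (lift (F.P K) x₀ + rel x₀ s))⁻¹ * Unitary.toUnits (suIncl (gJ s)) : GaugeTransf (F.P K) 0 (Matrix (Fin 2) (Fin 2) ℂ)ˣ)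
          (unitsField (toUField U)))) (iterBlockOf (K - n) x₀) (coverAt (F.P K) (K - n) yc)) ∧
                (∀ x ∈ cubeFam false (F.P K).L (fun μ => ((iterBlockOf (K - n) x₀ μ).val : ℤ) - t₀) M' (ρ + M + L + S) (K - n) 0, ∀ μ : Fin (F.P K).d,
      wt (F.P K).L (((F.L : ℝ)⁻¹) ^ (K - n)) 0 * ‖A x μ‖ ≤ cA ∧
        wt (F.P K).L (((F.L : ℝ)⁻¹) ^ (K - n)) 0 *
          ‖conjR ((1 : LSite (F.P K).d → Fin (F.P K).d → (Matrix (Fin 2) (Fin 2) ℂ)ˣ) (x - e μ) μ)⁻¹ (A (x - e μ) μ)‖ ≤ cA) ∧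
                (∀ j, j ≤ K - n → ∀ z ∈ cube (F.P K).L (fun μ => ((iterBlockOf (K - n) x₀ μ).val : ℤ) - t₀) M' (ρ + M + L + S) (K - n) j, ∀ ν' : Fin (F.P K).d,
      (F.L : ℝ) ^ j * ((F.L : ℝ)⁻¹) ^ (K - n) *
        ‖logCfg (((F.L : ℝ)⁻¹) ^ (K - n)) (mgauge (1 : LSite (F.P K).d → Fin (F.P K).d → (Matrix (Fin 2) (Fin 2) ℂ)ˣ) (gaugeExp lam)⁻¹
          (cfgExp (((F.L : ℝ)⁻¹) ^ (K - n)) A)) z ν'‖ ≤ Bsz * ε₀) ∧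
                (∀ j, j ≤ K - n → ∀ z ∈ cube (F.P K).L (fun μ => ((iterBlockOf (K - n) x₀ μ).val : ℤ) - t₀) M' (ρ + M + L + S) (K - n) j, ∀ ν' μ' : Fin (F.P K).d,
      z + e μ' ∈ cube (F.P K).L (fun μ => ((iterBlockOf (K - n) x₀ μ).val : ℤ) - t₀) M' (ρ + M + L + S) (K - n) 0 →
      ((F.L : ℝ) ^ j * ((F.L : ℝ)⁻¹) ^ (K - n)) ^ 2 * (F.L : ℝ) ^ (K - n) *
        ‖logCfg (((F.L : ℝ)⁻¹) ^ (K - n)) (mgauge (1 : LSite (F.P K).d → Fin (F.P K).d → (Matrix (Fin 2) (Fin 2) ℂ)ˣ) (gaugeExp lam)⁻¹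
            (cfgExp (((F.L : ℝ)⁻¹) ^ (K - n)) A)) (z + e μ') ν' -
          logCfg (((F.L : ℝ)⁻¹) ^ (K - n)) (mgauge (1 : LSite (F.P K).d → Fin (F.P K).d → (Matrix (Fin 2) (Fin 2) ℂ)ˣ) (gaugeExp lam)⁻¹
            (cfgExp (((F.L : ℝ)⁻¹) ^ (K - n)) A)) z ν'‖ ≤ Bsz * ε₀)  := by
  classical
  letI : CStarAlgebra (Matrix (Fin 2) (Fin 2) ℂ) := {}
  obtain ⟨gJ, A, κf, lam, hInAk, hInAx, htw, hsides, hchartTop, hAsa, hκfs, hκf0, hsa, hsupp, htr, h108, hmult, hlo, htopId, hA0⟩ :=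
    baseData_of_socketsT F L hF hnK hKn ρ S M M' hρ'def hε₀ hε hsdef hs6 hroom V U hU x₀ ht0 ht hadef hα₄ hB₀'H hB₂' hBG hBR hcAw hcDAw hcA13
      hCb hCl hCbρ hClB SLetτ hTorus
  subst hadef hρ'def
  have hL2 : 2 ≤ (F.P K).L := (F.P K).hL.2; have hLF : (F.P K).L = F.L := rfl; have hd2 : 2 ≤ (F.P K).d := by rw [T3Family.P_d]; norm_num
  have hkP : K - n ≤ (F.P K).m + (F.P K).K := FlatMinimizerH.le_T3 F n K; have hη : 0 < ((F.L : ℝ)⁻¹) ^ (K - n) := by positivity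
  have hρL : (F.P K).L ≤ (ρ + M + L + S) := (by rw [hLF, ← hF]; omega); have hM'1 : (1 : ℤ) ≤ M' := by linarith
  have hs0 : 0 ≤ s := by
    have : (1 : ℝ) ≤ M' := (by exact_mod_cast hM'1); have : (0 : ℝ) ≤ ((M' : ℝ) - 1) := (by linarith); rw [hsdef]; positivity
  have ha := corner_of_offset x₀ (K - n) (M' := M') ht0 ht; have hsites : (F.P K).sitesPerDir (K - n) = 2 * F.L ^ (F.m + n) := by show 2 * F.L ^ (F.m + K - (K - n)) = _; congr 2; omega
  have hroomW : 2 * ((F.P K).L ^ (K - n) * (M' + 1) + (ρ + M + L + S) * gs (F.P K).L (K - n)) ≤ (F.P K).sitesPerDir 0 := by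
    refine room_of_level_k (P := F.P K) hkP ?_; rw [hsites, ← hF]; omega
  have hU' : ∀ (x : LSite (F.P K).d) (κ : Fin (F.P K).d), pull (unitsField (toUField (GaugeField.gaugeAct gJ U))) 0 x κ ∈ unitaryUnits (Matrix (Fin 2) (Fin 2) ℂ) := fun x κ => by rw [pull_apply]; exact unitsField_mem_unitaryUnits _ _
  have hchart₀ : ∀ b ∈ {b : LSite (F.P K).d × Fin (F.P K).d |
        SideTouches (cubeFam false (F.P K).L (fun μ => ((iterBlockOf (K - n) x₀ μ).val : ℤ) - t₀) M' (ρ + M + L + S) (K - n) 0) b.1 b.2},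
      pull (unitsField (toUField (GaugeField.gaugeAct gJ U))) 0 b.1 b.2 = cfgExp (((F.L : ℝ)⁻¹) ^ (K - n)) A b.1 b.2 := fun b hb => (hsides b.1 b.2 hb).1
  have hu₁ : ∀ x : LSite (F.P K).d, (1 : LSite (F.P K).d → (Matrix (Fin 2) (Fin 2) ℂ)ˣ) x ∈ unitaryUnits (Matrix (Fin 2) (Fin 2) ℂ) := fun _ => (unitaryUnits _).one_mem
  have hW : mgauge (1 : LSite (F.P K).d → Fin (F.P K).d → (Matrix (Fin 2) (Fin 2) ℂ)ˣ) (1 : LSite (F.P K).d → (Matrix (Fin 2) (Fin 2) ℂ)ˣ)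
      (pull (unitsField (toUField (GaugeField.gaugeAct gJ U))) 0) = pull (unitsField (toUField (GaugeField.gaugeAct gJ U))) 0 := by
    funext z μ; have h1 : (1 : LSite (F.P K).d → (Matrix (Fin 2) (Fin 2) ℂ)ˣ) z = 1 := rfl; have h2 : (1 : LSite (F.P K).d → (Matrix (Fin 2) (Fin 2) ℂ)ˣ) (z + e μ) = 1 := rfl
    have h3 : (1 : LSite (F.P K).d → Fin (F.P K).d → (Matrix (Fin 2) (Fin 2) ℂ)ˣ) z μ = 1 := rfl
    rw [mgauge_apply, h1, h2, h3, B7Eq92Concrete.Rc_one_apply, one_mul, inv_one, mul_one]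
  have hknit := hknit_of_descent_BP' x₀ hρL ha hroomW U gJ hu₁ hW hsa; have hL1 : 1 ≤ (F.P K).L := le_trans (by norm_num) hL2
  have hc₁ : Real.exp (2 * s) - 1 ≤ ((F.L : ℝ)⁻¹) ^ (K - n) * (2 * (F.P K).L * (2 * s)) := by
    have h := hc₁_of_small (L := F.L) (by omega) 0 (cs := 2 * s) (by linarith) (by rw [pow_zero, inv_one, mul_one]; exact hs1); rw [pow_zero, inv_one, mul_one, zero_add] at h; rw [hKn, hLF]; exact h
  have hu₁SU : ∀ z : LSite (F.P K).d, (((1 : LSite (F.P K).d → (Matrix (Fin 2) (Fin 2) ℂ)ˣ) z : (Matrix (Fin 2) (Fin 2) ℂ)ˣ) : Matrix (Fin 2) (Fin 2) ℂ) ∈ Matrix.specialUnitaryGroup (Fin 2) ℂ :=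
    fun x => by show (((1 : (Matrix (Fin 2) (Fin 2) ℂ)ˣ)) : Matrix (Fin 2) (Fin 2) ℂ) ∈ Matrix.specialUnitaryGroup (Fin 2) ℂ; rw [Units.val_one]; exact (Matrix.specialUnitaryGroup (Fin 2) ℂ).one_mem
  have htwα : ∀ m', m' ≤ K - n → ∀ (x : LSite (F.P K).d) (ν : Fin (F.P K).d),
      tlo (F.P K).L (tLo (fun μ => ((iterBlockOf (K - n) x₀ μ).val : ℤ) - t₀) (ρ + M + L + S)) m' ≤ x →
      x + e ν ≤ thi (F.P K).L (tHi (fun μ => ((iterBlockOf (K - n) x₀ μ).val : ℤ) - t₀) M' (ρ + M + L + S)) m' →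
      ‖((avgIter (F.P K).L (pull (unitsField (toUField (GaugeField.gaugeAct gJ U))) 0) (K - n - m') x ν : (Matrix (Fin 2) (Fin 2) ℂ)ˣ) :
          Matrix (Fin 2) (Fin 2) ℂ) - 1‖ < α₁ := fun m' hm' x ν h1 h2 => lt_of_lt_of_le (htw m' hm' x ν h1 h2) hsα₁
  have htop := HTOP gJ 1 (pull (unitsField (toUField (GaugeField.gaugeAct gJ U))) 0) A (2 * s) (2 * (F.P K).L * (2 * s)) κf lam hu₁SU hW (by positivity) hbudget hc₁
    hchartTop hκfs hκf0 hsa htr htopId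
  have h16₀ : 16 * (2 * ((F.P K).L * cstar) + 8 * α₄) ≤ 1 :=
    le_trans (mul_le_mul_of_nonneg_left (le_mul_of_one_le_left hα₂ (by exact_mod_cast hL1 : (1 : ℝ) ≤ (F.P K).L)) (by norm_num)) h16
  -- (1.42): inner top class via ✓`H42_of_rows_γD` (knit predicate on print's class); collar residual = the datum-closed `H42topCrossT` INSTANTIATED AT THE BASE DATUM (`u₁ := 1`)
  have H42' := H42_of_rows_γD F hd2 hnK x₀ hρL ha hroomW hε₀ U gJ hInAk hInAx htwα hu₁ hW hchartTop hsa h108 htop hα₁ hα₂ hα3 hα4 h16 hsmallP hc₃P hsmall₁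
    hkb hbudget42 hr hr2 hwin
    (H42topCrossT gJ 1 (pull (unitsField (toUField (GaugeField.gaugeAct gJ U))) 0) A (2 * s) (2 * (F.P K).L * (2 * s)) κf lam hInAk hInAx htw hu₁SU hW (by positivity)
      hbudget hc₁ hchartTop hκfs hκf0 hsa htr htopId h108)
  have hρ1 : 1 ≤ ρ + M + L + S := le_trans hL1 hρL; have h66 := h66_of_fine (𝔸 := Matrix (Fin 2) (Fin 2) ℂ) hL2 (fun μ => ((iterBlockOf (K - n) x₀ μ).val : ℤ) - t₀) M' hρ1 (K - n)
    (U' := pull (unitsField (toUField (GaugeField.gaugeAct gJ U))) 0) (s := s)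
    (fun x ν h1 h2 => by have h := htw (K - n) le_rfl x ν h1 h2; rw [Nat.sub_self, B7Prop2Explicit.avgIter_zero] at h; exact h)
  have hdL1 : 1 ≤ (F.P K).d * (F.P K).L := le_trans hL1 (Nat.le_mul_of_pos_left _ (by omega)); have haβ4 : s ≤ 1 / 4 := hs6.trans (by norm_num); have hbdry := hbdry_of_hBd hdL1 hB₀.le hs0 hsα₁ hε₀.le hBd
  have haβα : s ≤ ((F.P K).d : ℝ) * (F.P K).L * α₁ := hsα₁.trans (le_mul_of_one_le_left hα₁.le (by exact_mod_cast hdL1))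
  have H59' := H59γ gJ hInAk hInAx htw
    (fun s => (((1 : LSite (F.P K).d → (Matrix (Fin 2) (Fin 2) ℂ)ˣ) * gaugeExp lam) (lift (F.P K) x₀ + rel x₀ s))⁻¹ * Unitary.toUnits (suIncl (gJ s)))
  have h129 : Restr129 (F.P K).L 0 (cubeLamS (F.P K).L (fun μ => ((iterBlockOf (K - n) x₀ μ).val : ℤ) - t₀) M' (ρ + M + L + S) (K - n) 0)
      (1 : LSite (F.P K).d → Fin (F.P K).d → (Matrix (Fin 2) (Fin 2) ℂ)ˣ) (1 : LSite (F.P K).d → (Matrix (Fin 2) (Fin 2) ℂ)ˣ) := by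
    intro j hj y _; obtain rfl : j = 0 := Nat.le_zero.1 hj; rw [Rbar_zero, Pi.one_apply, Units.val_one]
  have hcs0 : 2 * s * (((F.L : ℝ)⁻¹) ^ (K - n))⁻¹ ≤ cstar * (((F.P K).L : ℝ) ^ 0 * ((F.L : ℝ)⁻¹) ^ (K - n))⁻¹ := by rw [pow_zero, one_mul]; exact mul_le_mul_of_nonneg_right h2s (inv_nonneg.2 hη.le)
  have hdat : ∀ j, j ≤ 0 → ∀ b ∈ {b : LSite (F.P K).d × Fin (F.P K).d |
        SideTouches (cubeFam false (F.P K).L (fun μ => ((iterBlockOf (K - n) x₀ μ).val : ℤ) - t₀) M' (ρ + M + L + S) (K - n) j) b.1 b.2},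
      pull (unitsField (toUField (GaugeField.gaugeAct gJ U))) 0 b.1 b.2 = cfgExp (((F.L : ℝ)⁻¹) ^ (K - n)) A b.1 b.2 ∧ IsSelfAdjoint (A b.1 b.2) ∧
        ‖A b.1 b.2‖ ≤ cstar * (((F.P K).L : ℝ) ^ j * ((F.L : ℝ)⁻¹) ^ (K - n))⁻¹ := by
    intro j hj b hb; obtain rfl : j = 0 := Nat.le_zero.1 hj; obtain ⟨hch, hsz⟩ := hsides b.1 b.2 hb
    refine ⟨hch, hAsa _ _, le_trans ?_ hcs0⟩; rw [le_mul_inv_iff₀ hη, mul_comm]; exact hsz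
  have e01 : K - n = 0 + 1 := hKn; have hηL : (((F.L : ℝ)⁻¹) ^ (0 + 1))⁻¹ = ((F.P K).L : ℝ) ^ (0 + 1) := by rw [hLF]; simp
  have hη' := hη; have hInAk' := hInAk; have hInAx' := hInAx; have h129' := h129; have hdat' := hdat; have hsupp' := hsupp; have h108' := h108; have hmult' := hmult; have hlo' := hlo; have hA0' := hA0; have hknit' := hknit; have h66' := h66
  rw [e01] at hη' hInAk' hInAx' H42' H59' h129' hdat' hsupp' h108' hmult' hlo' hA0' hknit' h66'
  obtain ⟨hX1, hX2⟩ := siteSizeRows_of_topRows_γ (𝔸 := Matrix (Fin 2) (Fin 2) ℂ) hd2 hη' hL2 (a := fun μ => ((iterBlockOf (0 + 1) x₀ μ).val : ℤ) - t₀)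
    (M' := M') hρL (m := 0) rfl rfl rfl hU' hε₀ hα₁ hα₄ hB₀ hc hInAk' hInAx'
    hα3 hα4 h16₀ hd5 hsmallP hc₃P hside h50 hC₂ h61 hBbd hs0 haβ4 hbdry haβα h66' hcBlo hsmall hc₃ hsc hα₃' hs₁ hs₂ hs₃ hs₄ hs₅ hs₆ hprod8 _
    H42' H59' hu₁ (fun _ _ => rfl) hW h129' hdat' hα70 hcA0 hcA12 hsa hsupp' h108' hmult' hlo' hA0' hknit' hcsB hηL
  refine ⟨t₀, ht0, ht, gJ, 1, pull (unitsField (toUField (GaugeField.gaugeAct gJ U))) 0, A, 2 * s, 2 * (F.P K).L * (2 * s), κf, lam, α₄, cA,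
    hu₁SU, hW, hchart₀, by positivity, hbudget, hc₁, hchartTop, hκfs, hκf0, hα₄.le, hα70, hcA0, hcA12, hsa, htr, hsupp,
    h108 0 (Nat.zero_le _), hmult, htopId, hA0, (by rw [e01]; exact hX1), (by rw [e01]; exact hX2)⟩

end Summit.QuantumFields.YangMills.Theorems.HalvingHSiteRowsOfSocketsBaseTGammaT

end
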